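import Summits.AnomalousDissipation.AnomalousDissipation.Theses.TwoAndHalfD
import Summits.AnomalousDissipation.AnomalousDissipation.Theorems.TwoAndHalfDTwohalfdNegCertificate
import Summits.AnomalousDissipation.AnomalousDissipation.Theorems.TwoAndHalfDTwohalfdNegVerticalForce
import Summits.AnomalousDissipation.AnomalousDissipation.Theorems.TwoAndHalfDTwohalfdNegZeroSource
import Summits.AnomalousDissipation.AnomalousDissipation.Theorems.TwoAndHalfDTwohalfdThesisSiblingReduction
import Literature.Analysis.FluidPDE.TwoHalfSection
import Literature.Analysis.FunctionSpaces.TorusPlanarLift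
import Literature.Analysis.FunctionSpaces.TorusFourierModes
import Literature.Analysis.FunctionSpaces.TorusSobolevNorm

/-!
# Crux `TwoAndHalfD.TwohalfdThesis` (stmt-AnomalousDissipation-0206): the NEGATIVE LEMMA
# `X` is false modulo the planar sub-log strain law, and the disprover's three near-misses

Line `Sketch`, lead c6.  Bookkeeping over landed theorems of the route (no new analysis), recording on THIS item, by
name, where the mathematics of `X := TwohalfdThesis` (the zeroth law inside the `x₃`-invariant class) now stands:

* `SubLogStrain` — the hypothesis `H` of the negative lemma: the purely two-dimensional growth law "every
  bounded-mean-energy family of global Leray–Hopf solutions of the steadily forced 2-D Navier–Stokes equations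
  (one smooth divergence-free mean-zero force `g`, `ν_j → 0`, arbitrary `L²` data) has sub-logarithmic
  `limsup`-mean strain, `⟨‖∇v_j‖_{L²}⟩ / log(1/ν_j) → 0`".  It is, verbatim, the registered kernel stub
  `stub_subLogStrain` (S6) of the sibling crux `TwoAndHalfD.TwohalfdNeg` (stmt-AnomalousDissipation-0211) and the
  hypothesis of the landed transfer certificate `TwohalfdNeg.Certificate.twohalfdNeg_of_subLogStrain`; it is OPEN
  (expected true by enstrophy-cascade phenomenology, rms strain `~ log^{1/3}(1/ν)`; not a theorem).
* `TwohalfdThesis_false_of_SubLogStrain : SubLogStrain → ¬ TwohalfdThesis` — THE NEGATIVE LEMMA: composition of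
  `twohalfdNeg_of_subLogStrain` (0211's line certificate) with the refuting template
  `TwohalfdThesis.not_twohalfdThesis_of_twohalfdNeg` (kill shape `¬X ↔ TwohalfdNeg`, p133429).  So every witness of
  `X` must carry a planar Leray–Hopf family violating `SubLogStrain` (strain `≳ log(1/ν_j)` in the mean), in
  agreement with this line's strain gate for its kernel `W` (`stub_witnessStrainGate`, p104272).
* `not_twohalfdThesis_verticalForce`, `not_twohalfdThesis_planarForce`, `not_twohalfdThesis_singleShell`,
  `not_twohalfdThesis_stokesEigenfield` — the three NEAR-MISSES of the crux disprover's work file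
  (`Cruxes/TwohalfdThesis/Disproof.lean` §4: `not_twohalfdThesisVerticalForce`, `not_twohalfdThesisPlanarForce`,
  `not_twohalfdThesisSingleShell`, all `sorry` there) as UNCONDITIONAL theorems in `X`'s own `∃`-language: `X` is
  false for vertical forces `(0,0,h)`, for planar forces `(g,0)` (the third component must be sourced), and for
  Stokes-eigenfield forces `Δf = -4π²K f` (equivalently: planar part on one Fourier shell, any source).  They are the
  `∃`-negations of the landed `Tendsto` sub-cases of the negative crux (`VerticalForce.twohalfdNeg_twoHalf_verticalForce`,
  `ZeroSource.twohalfdNeg_twoHalf_zeroSource`, `Certificate.twohalfdNeg_twoHalf_singleShell`); the eigenfield form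
  needs only `Δ((g,h)∘π) = (Δg,Δh)∘π` and `𝓕(Δg)(k) = -4π²|k|² ĝ(k)`.

Supports stmt-AnomalousDissipation-0206 (negative lemma modulo `SubLogStrain`).
-/

noncomputable section

set_option linter.dupNamespace false

namespace Summit.AnomalousDissipation.AnomalousDissipation.Theorems.TwohalfdThesis.Negative

open MeasureTheory Set Filter Topology
open scoped ENNReal NNReal
open Literature.Analysis.FunctionSpaces Literature.Analysis.FluidPDE
open Summit.AnomalousDissipation.AnomalousDissipation.Theses.TwoAndHalfD
open Summit.AnomalousDissipation.AnomalousDissipation.Theorems.TwohalfdNeg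

/-! ## The hypothesis `H` and the negative lemma -/

/-- **`H = SubLogStrain`, the planar sub-log strain law** (verbatim the registered kernel stub `stub_subLogStrain`
of stmt-AnomalousDissipation-0211 and the hypothesis of `TwohalfdNeg.Certificate.twohalfdNeg_of_subLogStrain`): for
every smooth divergence-free mean-zero steady force `g` on `T²`, every `ν_j → 0` (`ν_j > 0`) and every family of
global Leray–Hopf solutions `v_j` of NS_{ν_j} forced by `g` (arbitrary `L²` data) with `ν`-uniformly bounded
`limsup`-mean energy, the `limsup`-mean strain is sub-logarithmic:
`⟨√‖∇v_j‖²_{L²}⟩ / log(1/ν_j) → 0`.  OPEN CONJECTURE stated in-tree (the negative crux's line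
`log-kantorovich-enstrophy-transfer`, `Cruxes/TwohalfdNeg/Lines/log_kantorovich_enstrophy_transfer.lean`, stub S6; idea card
`Cruxes/TwohalfdNeg/SketchIdeator2.lean`, `SubLogStrain`): a statement about two-dimensional Navier–Stokes only, expected from
the Kraichnan–Batchelor log-corrected enstrophy cascade (rms strain `~ log^{1/3}(1/ν)`), neither proved nor refuted; tagged
`@[conjecture]` (obligation node, provable / refutable by name). [folklore] -/
@[conjecture]
def SubLogStrain : Prop :=
  ∀ g : UnitAddTorus (Fin 2) → EuclideanSpace ℝ (Fin 2),
    Torus.IsSmooth g → Torus.IsDivFree g → Torus.HasZeroMean g →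
    ∀ (ν : ℕ → ℝ) (v₀ : ℕ → UnitAddTorus (Fin 2) → EuclideanSpace ℝ (Fin 2))
      (v : ℕ → ℝ → UnitAddTorus (Fin 2) → EuclideanSpace ℝ (Fin 2)),
      (∀ j, 0 < ν j) → Tendsto ν atTop (𝓝 0) →
      (∀ j, Torus.IsGlobalLerayHopf (ν j) (fun _ => g) (v₀ j) (v j)) →
      (∃ E : ℝ, ∀ j, meanEnergy (v j) ≤ E) →
      Tendsto (fun j => longTimeAvgSup (fun t => Real.sqrt (Torus.eGradNormSq (v j t)).toReal) /
        Real.log (ν j)⁻¹) atTop (𝓝 0)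

/-- **NEGATIVE LEMMA: `X` is false modulo `SubLogStrain`.**  If every bounded-mean-energy steadily forced planar
Leray–Hopf family has sub-log mean strain, then there is NO zeroth law inside the `x₃`-invariant class:
`¬ TwohalfdThesis`.  Composition of the negative crux's transfer certificate
`Certificate.twohalfdNeg_of_subLogStrain : SubLogStrain → TwohalfdNeg` with the refuting template
`not_twohalfdThesis_of_twohalfdNeg` (kill shape `¬X ↔ TwohalfdNeg`). [folklore] -/
theorem TwohalfdThesis_false_of_SubLogStrain (hS6 : SubLogStrain) : ¬ TwohalfdThesis :=
  not_twohalfdThesis_of_twohalfdNeg (Certificate.twohalfdNeg_of_subLogStrain hS6)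

/-! ## The disprover's near-misses, unconditionally -/

/-- A sequence tending to `0` cannot stay above a positive floor. [folklore] -/
theorem false_of_tendsto_zero_of_le {D : ℕ → ℝ} {ε : ℝ} (hε : 0 < ε) (hD : ∀ j, ε ≤ D j)
    (h : Tendsto D atTop (𝓝 0)) : False := by
  obtain ⟨j, hj⟩ := (h.eventually (gt_mem_nhds hε)).exists
  exact lt_irrefl ε (lt_of_le_of_lt (hD j) hj)

/-- **Near-miss 1 (vertical force): `X` is false for `f = (0,0,h) = twoHalf 0 h`.**  For every smooth mean-zero
`h`, no family of `x₃`-invariant global Leray–Hopf solutions of NS_{ν_j} forced by `twoHalf 0 h`, `ν_j → 0`, with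
bounded `limsup`-mean energy has a positive dissipation floor: the planar part is unforced (sub-log strain for free,
`VerticalForce.subLogStrainFor_zero`) and the negative crux's engine applies
(`VerticalForce.twohalfdNeg_twoHalf_verticalForce`).  The `∃`-negation closes the disprover's
`not_twohalfdThesisVerticalForce` (`Cruxes/TwohalfdThesis/Disproof.lean` §4). [folklore] -/
theorem not_twohalfdThesis_verticalForce :
    ¬ ∃ h : UnitAddTorus (Fin 2) → ℝ, Torus.IsSmooth h ∧ Torus.HasZeroMean h ∧
      ∃ (ν : ℕ → ℝ) (u₀ : ℕ → UnitAddTorus (Fin 3) → EuclideanSpace ℝ (Fin 3))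
        (u : ℕ → ℝ → UnitAddTorus (Fin 3) → EuclideanSpace ℝ (Fin 3)),
        (∀ j, 0 < ν j) ∧ Tendsto ν atTop (𝓝 0) ∧
        (∀ j, Torus.IsGlobalLerayHopf (ν j)
          (fun _ => Torus.twoHalf (0 : UnitAddTorus (Fin 2) → EuclideanSpace ℝ (Fin 2)) h) (u₀ j) (u j)) ∧
        (∀ j (t : ℝ) (s : UnitAddCircle) (x : UnitAddTorus (Fin 3)), u j t (x + Pi.single (2 : Fin 3) s) = u j t x) ∧
        (∃ E : ℝ, ∀ j, meanEnergy (u j) ≤ E) ∧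
        ∃ ε : ℝ, 0 < ε ∧ ∀ j, ε ≤ meanDissipation (ν j) (u j) := by
  rintro ⟨h, hhs, hhz, ν, u₀, u, hν, hν0, hLH, hinv, hE, ε, hε, hD⟩
  exact false_of_tendsto_zero_of_le hε hD
    (VerticalForce.twohalfdNeg_twoHalf_verticalForce h hhs hhz ν u₀ u hν hν0 hLH hinv hE)

/-- **Near-miss 2 (planar force): `X` is false for `f = (g,0) = twoHalf g 0` — a witness must SOURCE its third
component.**  For every smooth divergence-free mean-zero planar `g` (any number of shells), no family of
`x₃`-invariant global Leray–Hopf solutions of NS_{ν_j} forced by `twoHalf g 0`, `ν_j → 0`, with bounded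
`limsup`-mean energy has a positive dissipation floor (`ZeroSource.twohalfdNeg_twoHalf_zeroSource`: planar
dissipation `→ 0` by Alexakis–Doering, the unsourced scalar's releases dissipate nothing).  Closes the disprover's
`not_twohalfdThesisPlanarForce`. [folklore] -/
theorem not_twohalfdThesis_planarForce :
    ¬ ∃ g : UnitAddTorus (Fin 2) → EuclideanSpace ℝ (Fin 2), Torus.IsSmooth g ∧ Torus.IsDivFree g ∧
      Torus.HasZeroMean g ∧
      ∃ (ν : ℕ → ℝ) (u₀ : ℕ → UnitAddTorus (Fin 3) → EuclideanSpace ℝ (Fin 3))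
        (u : ℕ → ℝ → UnitAddTorus (Fin 3) → EuclideanSpace ℝ (Fin 3)),
        (∀ j, 0 < ν j) ∧ Tendsto ν atTop (𝓝 0) ∧
        (∀ j, Torus.IsGlobalLerayHopf (ν j) (fun _ => Torus.twoHalf g 0) (u₀ j) (u j)) ∧
        (∀ j (t : ℝ) (s : UnitAddCircle) (x : UnitAddTorus (Fin 3)), u j t (x + Pi.single (2 : Fin 3) s) = u j t x) ∧
        (∃ E : ℝ, ∀ j, meanEnergy (u j) ≤ E) ∧
        ∃ ε : ℝ, 0 < ε ∧ ∀ j, ε ≤ meanDissipation (ν j) (u j) := by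
  rintro ⟨g, hgs, hgd, hgz, ν, u₀, u, hν, hν0, hLH, hinv, hE, ε, hε, hD⟩
  exact false_of_tendsto_zero_of_le hε hD
    (ZeroSource.twohalfdNeg_twoHalf_zeroSource g hgs hgd hgz ν u₀ u hν hν0 hLH hinv hE)

/-- **Near-miss 3 (single shell, Fourier form): `X` is false whenever the planar part of the force lives on ONE
Fourier shell**, whatever the shell, the (smooth mean-zero) source `h` and the data
(`Certificate.twohalfdNeg_twoHalf_singleShell`: Tran–Shepherd's monoscale constraint bounds the planar strain
uniformly in `ν`, and the negative crux's engine applies). [folklore] -/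
theorem not_twohalfdThesis_singleShell :
    ¬ ∃ (g : UnitAddTorus (Fin 2) → EuclideanSpace ℝ (Fin 2)) (h : UnitAddTorus (Fin 2) → ℝ),
      Torus.IsSmooth g ∧ Torus.IsDivFree g ∧ Torus.HasZeroMean g ∧ Torus.IsSmooth h ∧ Torus.HasZeroMean h ∧
      (∃ m : ℝ, ∀ k : Fin 2 → ℤ, Torus.freqNormSq k ≠ m →
        UnitAddTorus.mFourierCoeff (EuclideanSpace.complexify ∘ g) k = 0) ∧
      ∃ (ν : ℕ → ℝ) (u₀ : ℕ → UnitAddTorus (Fin 3) → EuclideanSpace ℝ (Fin 3))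
        (u : ℕ → ℝ → UnitAddTorus (Fin 3) → EuclideanSpace ℝ (Fin 3)),
        (∀ j, 0 < ν j) ∧ Tendsto ν atTop (𝓝 0) ∧
        (∀ j, Torus.IsGlobalLerayHopf (ν j) (fun _ => Torus.twoHalf g h) (u₀ j) (u j)) ∧
        (∀ j (t : ℝ) (s : UnitAddCircle) (x : UnitAddTorus (Fin 3)), u j t (x + Pi.single (2 : Fin 3) s) = u j t x) ∧
        (∃ E : ℝ, ∀ j, meanEnergy (u j) ≤ E) ∧
        ∃ ε : ℝ, 0 < ε ∧ ∀ j, ε ≤ meanDissipation (ν j) (u j) := by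
  rintro ⟨g, h, hgs, hgd, hgz, hhs, hhz, hshell, ν, u₀, u, hν, hν0, hLH, hinv, hE, ε, hε, hD⟩
  exact false_of_tendsto_zero_of_le hε hD
    (Certificate.twohalfdNeg_twoHalf_singleShell g h hgs hgd hgz hhs hhz hshell ν u₀ u hν hν0 hLH hinv hE)

/-- **Planar part of a Stokes eigenfield is single-shell.**  If the `x₃`-invariant lift `twoHalf g h` of smooth planar
data satisfies `Δ(twoHalf g h) = -(4π²K) • twoHalf g h` pointwise, then `ĝ(k) = 0` off the shell `|k|² = K`
(`Δ((g,h)∘π) = (Δg,Δh)∘π`, planar projection along the section, `𝓕(Δg)(k) = -4π²|k|² ĝ(k)`). [folklore] -/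
theorem mFourierCoeff_eq_zero_of_laplacian_twoHalf {g : UnitAddTorus (Fin 2) → EuclideanSpace ℝ (Fin 2)}
    {h : UnitAddTorus (Fin 2) → ℝ} (hgs : Torus.IsSmooth g) (hhs : Torus.IsSmooth h) {K : ℝ}
    (hlap : ∀ x, Torus.laplacian (Torus.twoHalf g h) x = -(4 * Real.pi ^ 2 * K) • Torus.twoHalf g h x)
    {k : Fin 2 → ℤ} (hk : Torus.freqNormSq k ≠ K) :
    UnitAddTorus.mFourierCoeff (EuclideanSpace.complexify ∘ g) k = 0 := by
  -- the planar Laplacian is an eigen-relation for `g`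
  have hg : Torus.laplacian g = (-(4 * Real.pi ^ 2 * K)) • g := by
    funext y
    have h1 := hlap (Torus.planarSect y)
    rw [Torus.laplacian_twoHalf hgs hhs] at h1
    have h2 := congrArg Torus.planarProjE h1
    rw [Torus.planarProjE_twoHalf_planarSect, map_smul, Torus.planarProjE_twoHalf_planarSect] at h2
    rw [h2, Pi.smul_apply]
  -- compare the two expressions of `𝓕(Δg)(k)`
  have hF := Torus.mFourierCoeff_complexify_laplacian hgs k
  have hlin : (EuclideanSpace.complexify ∘ Torus.laplacian g) =
      ((-(4 * Real.pi ^ 2 * K) : ℝ) : ℂ) • (EuclideanSpace.complexify ∘ g) := by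
    funext y
    simp only [hg, Function.comp_apply, Pi.smul_apply, LinearIsometry.map_smul, Complex.coe_smul]
  rw [hlin, Torus.mFourierCoeff_const_smul] at hF
  -- `hF : ↑(-4π²K) • ĝ(k) = -(↑(4π²|k|²) • ĝ(k))`
  have hsum : (((-(4 * Real.pi ^ 2 * K) : ℝ) : ℂ) + ((4 * Real.pi ^ 2 * Torus.freqNormSq k : ℝ) : ℂ)) •
      UnitAddTorus.mFourierCoeff (EuclideanSpace.complexify ∘ g) k = 0 := by
    rw [add_smul, hF, neg_add_cancel]
  rcases smul_eq_zero.1 hsum with h0 | h0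
  · exfalso
    apply hk
    have hre := congrArg Complex.re h0
    simp only [Complex.add_re, Complex.ofReal_re, Complex.zero_re] at hre
    have hpi : (0 : ℝ) < 4 * Real.pi ^ 2 := by positivity
    have hmul : 4 * Real.pi ^ 2 * (Torus.freqNormSq k - K) = 0 := by linarith
    rcases mul_eq_zero.1 hmul with h1 | h1
    · exact absurd h1 hpi.ne'
    · linarith
  · exact h0

/-- **Near-miss 3' (the disprover's form): `X` is false when `f` is a Stokes eigenfield, `Δf = -4π²K f`.**  An
`x₃`-invariant smooth divergence-free mean-zero force is `twoHalf g h` of its sections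
(`Torus.eq_twoHalf_of_forall_add_single'`), with `g` smooth divergence-free mean-zero and `h` smooth mean-zero; the
eigen-relation puts `ĝ` on the shell `|k|² = K` (`mFourierCoeff_eq_zero_of_laplacian_twoHalf`), and
`not_twohalfdThesis_singleShell` applies.  Closes the disprover's `not_twohalfdThesisSingleShell`
(`Cruxes/TwohalfdThesis/Disproof.lean` §4) unconditionally. [folklore] -/
theorem not_twohalfdThesis_stokesEigenfield :
    ¬ ∃ (K : ℕ) (f : UnitAddTorus (Fin 3) → EuclideanSpace ℝ (Fin 3)),
      (∀ (s : UnitAddCircle) (x : UnitAddTorus (Fin 3)), f (x + Pi.single (2 : Fin 3) s) = f x) ∧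
      Torus.IsSmooth f ∧ Torus.IsDivFree f ∧ Torus.HasZeroMean f ∧
      (∀ x, Torus.laplacian f x = -(4 * Real.pi ^ 2 * (K : ℝ)) • f x) ∧
      ∃ (ν : ℕ → ℝ) (u₀ : ℕ → UnitAddTorus (Fin 3) → EuclideanSpace ℝ (Fin 3))
        (u : ℕ → ℝ → UnitAddTorus (Fin 3) → EuclideanSpace ℝ (Fin 3)),
        (∀ j, 0 < ν j) ∧ Tendsto ν atTop (𝓝 0) ∧
        (∀ j, Torus.IsGlobalLerayHopf (ν j) (fun _ => f) (u₀ j) (u j)) ∧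
        (∀ j (t : ℝ) (s : UnitAddCircle) (x : UnitAddTorus (Fin 3)), u j t (x + Pi.single (2 : Fin 3) s) = u j t x) ∧
        (∃ E : ℝ, ∀ j, meanEnergy (u j) ≤ E) ∧
        ∃ ε : ℝ, 0 < ε ∧ ∀ j, ε ≤ meanDissipation (ν j) (u j) := by
  rintro ⟨K, f, hfinv, hfs, hfd, hfz, hlap, ν, u₀, u, hν, hν0, hLH, hinv, hE, ε, hε, hD⟩
  -- sections of the `x₃`-invariant force
  set g : UnitAddTorus (Fin 2) → EuclideanSpace ℝ (Fin 2) := fun y => Torus.planarProjE (f (Torus.planarSect y))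
    with hg_def
  set h : UnitAddTorus (Fin 2) → ℝ := fun y => f (Torus.planarSect y) 2 with hh_def
  have hf : f = Torus.twoHalf g h := Torus.eq_twoHalf_of_forall_add_single' hfinv
  rw [hf] at hfs hfd hfz hlap hLH
  have hgs : Torus.IsSmooth g := Torus.isSmooth_left_of_twoHalf hfs
  have hhs : Torus.IsSmooth h := Torus.isSmooth_right_of_twoHalf hfs
  have hgd : Torus.IsDivFree g := Torus.isDivFree_of_twoHalf hfd
  obtain ⟨hgz, hhz⟩ := Torus.hasZeroMean_of_twoHalf hgs.continuous.integrable_unitAddTorus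
    hhs.continuous.integrable_unitAddTorus hfz
  have hshell : ∃ m : ℝ, ∀ k : Fin 2 → ℤ, Torus.freqNormSq k ≠ m →
      UnitAddTorus.mFourierCoeff (EuclideanSpace.complexify ∘ g) k = 0 :=
    ⟨(K : ℝ), fun k hk => mFourierCoeff_eq_zero_of_laplacian_twoHalf hgs hhs hlap hk⟩
  exact not_twohalfdThesis_singleShell
    ⟨g, h, hgs, hgd, hgz, hhs, hhz, hshell, ν, u₀, u, hν, hν0, hLH, hinv, hE, ε, hε, hD⟩

end Summit.AnomalousDissipation.AnomalousDissipation.Theorems.TwohalfdThesis.Negative
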